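import Literature.NumberTheory.Automorphic.UnitaryGroupArchCharacterTraceClassOfNuclear
import Literature.NumberTheory.Automorphic.UnitaryGroupArchIntegratedOperatorNuclearOfKTypeGrowth
import Literature.NumberTheory.Automorphic.IrreducibleUnitaryKTypeGrowth
import HarnessLib

/-!
# The trace-class letter A5 [Knapp1986, Thm. 10.2] FROM Varadarajan's two letters: nuclearity under `K`-type growth (Thm. 22) and the
# `K`-type growth of irreducible unitary representations (Thm. 19)

Topic `NumberTheory/Automorphic`; namespace `Literature.NumberTheory.Automorphic.UnitaryGroup` (home of the letter ★ `ArchIntegratedOperatorTraceClass`).  Theorems only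
(no definition, no named fact, no instance, no `sorry`).  Cell `hodgecm-mathlib`, line T1a `Cruxes/H413/Lines/F0_T1a_ArchCharactersLinIndep.lean`, stub `stub_traceClass`
= letter A5 (books #91), road HC (lead F0P3b-p01 (g2); letters typed by typ-T1a (g0); composition certified by paste `F0/P3/typ-T1a/CERT-A5-of-V22-V19.bypaste.T1ag0.lean`
e7c02ce99caa477f, here BY IMPORT).

THE COMPOSITION.  ★ V22 `UnitaryGroup.ArchIntegratedOperatorNuclearOfKTypeGrowth L ι H T hT νinf` [Varadarajan1989, §5.4 Thm. 22]: a unitary strongly continuous `ϖ` of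
`U(2,1)` whose `K`-isotypic subspaces are finite-dimensional of polynomial growth `dim E(τ) ≤ c·d(τ)^r` has `(ϖ ∘ archProjUForm)(φ)` nuclear along some Hilbert basis for
every archimedean-smooth compactly supported `φ`; ★ V19 `IrreducibleUnitaryKTypeGrowth` [Varadarajan1989, §5.4 Thm. 19 = HarishChandra1954]: a unitary globalization of
an irreducible `(𝔤, K)`-class of `U(p,q)` has `dim E(τ) ≤ c·d(τ)²`; ★ H0′ `archIntegratedOperatorTraceClass_of_summable_norm_apply` (p829136): nuclearity along one
Hilbert basis gives the three trace-class clauses of A5.  Hence A5 ⇐ V22 ∧ V19, kernel-checked; when V22 is PAID in-house (nodes H3a∕H3b Casimir decay, H4a∕H4b lattice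
sum and `Û(2)×Û(1)` dictionary, ★ H2 blocks) the letter #91 [Knapp1986 Thm. 10.2] is re-denominated to V19 alone.

* `archIntegratedOperatorTraceClass_of_nuclearOfKTypeGrowth` — one frame: `V22 (frame) → V19 → A5 (frame)`;
* `archIntegratedOperatorTraceClass_forall_of_nuclearOfKTypeGrowth` — all frames (the TYPE of `stub_traceClass` after the two letter binders).

HONEST LABEL: a composition of two booked letters, not a discharge; HC_CM is proved only modulo the 2 remaining named inputs (hLiu418, h413) until rung 0 closes.

## References
* V. S. Varadarajan, *An Introduction to Harmonic Analysis on Semisimple Lie Groups* (1989), §5.4 Thm. 19, Lemma 21, Thm. 22 (PDF pp. 155, 159–161) [Varadarajan1989].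
* A. W. Knapp, *Representation Theory of Semisimple Groups: An Overview Based on Examples* (1986), Thm. 10.2 [Knapp1986].
* Harish-Chandra, *Representations of semisimple Lie groups. II*, Trans. AMS 76 (1954) [HarishChandra1954].
-/

set_option autoImplicit false

noncomputable section

open NumberField MeasureTheory CompactlySupported
-- `Classical`: the place subtypes indexing `mixedSpace L` are `Fintype` classically, as in ★ `UnitaryGroupArchCharacterTraceClass` (token-for-token binder match).
open scoped Matrix InnerProductSpace ENNReal NNReal Classical

namespace Literature.NumberTheory.Automorphic.UnitaryGroup

open Literature.RepresentationTheory.KonnoKonno2007 Literature.RepresentationTheory.KonnoKonno2007.RealDualPair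

/-- **A5 [Knapp1986 Thm. 10.2] ⇐ V22 [Varadarajan1989 Thm. 22] ∧ V19 [Varadarajan1989 Thm. 19], at one frame**: for every CM frame `(L, ι, H, T)` and Borel measure
`νinf` on `G′_∞`, nuclearity under `K`-type growth together with the quadratic `K`-type growth of irreducible unitary representations gives the trace-class letter
★ `ArchIntegratedOperatorTraceClass L ι H T hT νinf` (through ★ `archIntegratedOperatorTraceClass_of_summable_norm_apply`).
[cite: Varadarajan1989, §5.4 Thm. 22 and Thm. 19] [cite: Knapp1986, Thm. 10.2] -/
theorem archIntegratedOperatorTraceClass_of_nuclearOfKTypeGrowth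
    (L : Type) [Field L] [NumberField L] [IsCMField L] (ι : L →+* ℂ) (H : Matrix (Fin 3) (Fin 3) L) (T : GL (Fin 3) ℂ)
    (hT : (T : Matrix (Fin 3) (Fin 3) ℂ)ᴴ * H.map ι * (T : Matrix (Fin 3) (Fin 3) ℂ) = Literature.Geometry.ComplexHyperbolic.BallModel.J)
    (νinf : @Measure (arch (↥(maximalRealSubfield L)) L (IsCMField.complexConj L) 3 H) (borel _))
    (h22 : ArchIntegratedOperatorNuclearOfKTypeGrowth L ι H T hT νinf) (h19 : IrreducibleUnitaryKTypeGrowth) :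
    ArchIntegratedOperatorTraceClass L ι H T hT νinf :=
  archIntegratedOperatorTraceClass_of_summable_norm_apply L ι H T hT νinf fun hν x E _ _ _ ϖ hϖ φ hφc hφs hφ' => by
    obtain ⟨c, hc⟩ := h19 (Fin 2) (Fin 1) x E ϖ hϖ
    exact h22.summable_norm_apply_of_isUnitaryGlobalization L ι H T hT hν x E ϖ hϖ ⟨c, 2, fun W _ _ _ τ hτ => hc W τ hτ⟩ φ hφc hφs hφ'

/-- **The same at ALL frames** — the TYPE of the T1a Lines stub `stub_traceClass` from the ∀-closed V22 and V19: the shape in which a future edition of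
`Cruxes/H413/Lines/F0_T1a_ArchCharactersLinIndep.lean` re-denominates A5 once V22 is paid. [cite: Varadarajan1989, §5.4 Thm. 22 and Thm. 19] [cite: Knapp1986, Thm. 10.2] -/
theorem archIntegratedOperatorTraceClass_forall_of_nuclearOfKTypeGrowth
    (h22 : ∀ (L : Type) [Field L] [NumberField L] [IsCMField L] (ι : L →+* ℂ) (H : Matrix (Fin 3) (Fin 3) L) (T : GL (Fin 3) ℂ)
      (hT : (T : Matrix (Fin 3) (Fin 3) ℂ)ᴴ * H.map ι * (T : Matrix (Fin 3) (Fin 3) ℂ) = Literature.Geometry.ComplexHyperbolic.BallModel.J)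
      (νinf : @Measure (arch (↥(maximalRealSubfield L)) L (IsCMField.complexConj L) 3 H) (borel _)),
      ArchIntegratedOperatorNuclearOfKTypeGrowth L ι H T hT νinf)
    (h19 : IrreducibleUnitaryKTypeGrowth) :
    ∀ (L : Type) [Field L] [NumberField L] [IsCMField L] (ι : L →+* ℂ) (H : Matrix (Fin 3) (Fin 3) L) (T : GL (Fin 3) ℂ)
      (hT : (T : Matrix (Fin 3) (Fin 3) ℂ)ᴴ * H.map ι * (T : Matrix (Fin 3) (Fin 3) ℂ) = Literature.Geometry.ComplexHyperbolic.BallModel.J)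
      (νinf : @Measure (arch (↥(maximalRealSubfield L)) L (IsCMField.complexConj L) 3 H) (borel _)),
      ArchIntegratedOperatorTraceClass L ι H T hT νinf :=
  fun L _ _ _ ι H T hT νinf => archIntegratedOperatorTraceClass_of_nuclearOfKTypeGrowth L ι H T hT νinf (h22 L ι H T hT νinf) h19

end Literature.NumberTheory.Automorphic.UnitaryGroup

end
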